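import Summits.QuantumFields.YangMills.Theorems.PencilRigidityHypercubicLimitScaledShiftedBound
import Summits.QuantumFields.YangMills.Theorems.PencilRigidityHypercubicLimitUniformBoundOfScaledShiftedBound
import HarnessLib

/-!
# Crux `HypercubicLimit` (stmt-QuantumFields-8646), line `conditional-mean-telescoping`: registered stub `stub_uniformBound`

Support file (`--supports stmt-QuantumFields-8646`, c2 seat, reshape 3): **leg (U) of the closure** —
`GaussianDomination → WindowRegularity → UniformBound`, the composition of the abstract scaled shifted bound
(`stub_scaledShiftedBound`, `…ScaledShiftedBound.lean`) with its instantiation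
(`uniformBound_of_scaledShiftedBound`, `…UniformBoundOfScaledShiftedBound.lean`).
-/

set_option autoImplicit false

namespace Summit.QuantumFields.YangMills.Cruxes.HypercubicLimit.ConditionalMeanTelescoping

/-- **`stub_uniformBound`** (registered stub of the reshape-3 skeleton, crux stmt-QuantumFields-8646, c2 seat): Gaussian
domination + window regularity (a),(c) ⇒ the a-uniform E0′-type bound on the RP-normalised plane-string distributions at
shifted evaluation points. -/
theorem stub_uniformBound : GaussianDomination → WindowRegularity → UniformBound :=
  uniformBound_of_scaledShiftedBound stub_scaledShiftedBound

end Summit.QuantumFields.YangMills.Cruxes.HypercubicLimit.ConditionalMeanTelescoping
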